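/-
Copyright (c) 2026 the pub-hodgecm-mathlib formalisation cell (harness21).  Prover seat hodgecm-mathlib-LH7-p06 (g2), Track A «FOUR-FRAME» fan seat on VALVE DEAL of
L1 LEAD F0P6-plan (g14) BATCH #148 (3) 2026-09-04T23:31:24Z «SECOND HAND under K2E3-p06 (g6) on B2a′ W-FE-2: the Γ-FACTOR LETTER of `twistedHeadSum_intertwined_eq_mul`»;
desk K2E3-p14 (g9); W-FE-1 = K2E3-p06 (g6) `K2LiuTwistedFarBall` ∕ `K2LiuRankOneWhittakerFunctionalEquation`.
-/
import Literature.NumberTheory.Automorphic.TateGaussSums          -- ★ `TateDirect`: shells, unramified shell evaluations, shell expansions on balls (brings ★ `LocalFieldHaarBalls`: `d^×x`)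
import Literature.NumberTheory.Automorphic.TateLocalZetaShells     -- ★ `unitFiltration_mem_nhds_one`, `isInvInvariant_of_isHaarMeasure_units`, `setIntegral_primePowBall_addChar_mul`
import Mathlib.MeasureTheory.Group.Integral
import HarnessLib

/-!
# Crux `HLiu418`, organ U1-CT-ind STAGE 3 («U1-glob»), brick B2a′ (the rank-one ψ-Whittaker functional equation), file W-FE-Γ: THE Γ-FACTOR LETTER —
# `Γ^N_c(e) := ∫_{x ∉ 𝔭^N} C₀ ν(x)⁻¹ ‖x‖^{−e} ψ(c x⁻¹) dμ(x) = C₀ · μ(𝒪) · W^{m′−1} · (W − q⁻¹) ∕ (1 − W)`, `W = ν(ϖ) q^{1−e}`, `m′ = cond(ψ) − ord(c)` (unramified `ν`)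

Cell `hodgecm-mathlib`, crux item hLiu418 = `stmt-HodgeConjecture-24832` (helper lane `--supports … --as helper`, count-neutral).  THEOREMS ONLY (no `def`,
no `instance`, no `notation`, no named-fact hypothesis, no `sorry`).  GROUP-FREE local Tate analysis over an abstract non-archimedean local field `F` (at `U(2,2)_v`:
`F = F_v`); the letters `(ν, C₀, e, T, hT, ψ, c, N)` are those of W-FE-1 `K2LiuRankOneWhittakerFunctionalEquation.twistedHeadSum_intertwined_eq_mul` (K2E3-p06 (g6)):
its right-hand factor is `∫ x in (primePowBall F (M + k_κ + 1))ᶜ, T x * ψ (σ * (κ * x⁻¹)) ∂μ` with `T x = C₀ · ν(x)⁻¹ · ‖x‖^{−e}` on units — here `c := σκ`, `N := M + k_κ + 1`.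

THE POINT ([CasselmanShalika1980, §2–§4]; [Tate1950, §2.5]; [GanTakeda2011SiegelWeil, §7 Lemma 7.4]).  The Γ-factor of the rank-one ψ_c-Whittaker functional equation is a TATE
INTEGRAL after ONE inversion, and the inversion costs nothing: `d^×x = ‖x‖⁻¹dμ(x)` pulled back to `Fˣ` is a Haar measure of the abelian group `Fˣ` (★ `LocalFieldHaar.
isHaarMeasure_unitsMeasure`), hence inversion invariant (★ `isInvInvariant_of_isHaarMeasure_units`), so **`∫ ‖x‖⁻¹ G(x⁻¹) dμ = ∫ ‖x‖⁻¹ G(x) dμ` for EVERY `G`** (§1).  With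
`G(y) = 𝟙_{𝔭^{1−N}∖0}(y)·C₀ ν(y) ‖y‖^{e−1} ψ(cy)` this turns `Γ^N_c(e)` into `C₀ · ∫_{𝔭^{1−N} ∖ 0} ψ(cy)·ν̃(y)·‖y‖^{e−2} dμ(y)` (§2; `ν̃` = `ν` extended by `0`, ★ `TateDirect`'s
currency), whose shell expansion (★ `TateDirect.integrableOn_and_hasSum_mul_extend_cpow`, strip `re e > 1`) is, for `ν` UNRAMIFIED and unitary (`α = ν(ϖ)`), Tate's orthogonality
shell by shell: `J_k(c) := ∫_{𝔭^k} ψ(cy) dμ = μ(𝔭^k)·[k ≥ m′]`, `m′ = cond(ψ) − ord(c)`, so the shell `‖y‖ = q^{−k}` contributes `μ(𝒪)·W^k·([k ≥ m′] − q⁻¹[k ≥ m′ − 1])`,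
`W := α·q^{1−e}` (`‖W‖ < 1`), and for `1 − N ≤ m′ − 1` (W-FE-1's thresholds `−M ≤ j`, `σ ∉ 𝔭^{c_ψ−j}` give exactly this) the sum is
  **`Γ^N_c(e) = C₀ · μ(𝒪) · W^{m′−1} · (W − q⁻¹) · (1 − W)⁻¹`** — i.e. **`Γ = L(e−1, ν)·Γ̃`** with `L(e−1,ν)⁻¹ = 1 − ν(ϖ)q^{1−e}` (★ T1 `lFactor`) and the Laurent MONOMIAL
`Γ̃(e) = C₀ μ(𝒪) W^{m′−1}(W − q⁻¹)`, regular everywhere; AT THE CENTRE (`W(e₀) = α`): inert `α = −1` ⇒ `Γ̃ = ±C₀ μ(𝒪)(1 + q⁻¹) ≠ 0` iff `C₀ ≠ 0` — W-FE-2's «`Γ̃(1) ≠ 0`».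
* §0 `continuous_of_unramified` (an unramified unitary `ν : Fˣ →* ℂˣ` is continuous — so it is a `QuasiChar` inside the proofs; no `def`).
* §1 **`integral_normAbs_inv_smul_comp_inv`** (the free inversion `∫ ‖x‖⁻¹ • G(x⁻¹) = ∫ ‖x‖⁻¹ • G(x)`), `inv_mem_primePowBall_iff_not_mem`.
* §2 **`setIntegral_compl_tail_mul_addChar_inv_eq`** — `Γ^N_c(e) = C₀·∫_{𝔭^{1−N}∖0} ψ(cy) ν̃(y) ‖y‖^{e−2} dμ` (every `e`, no integrability: both sides junk together).
* §3 `setIntegral_shell_addChar_mul_eq` (`∫_{‖y‖=q^{−k}} ψ(cy) = J_k − J_{k+1}` with the conductor test `[m′ ≤ k]`), **`integral_ball_addChar_mul_extend_cpow_eq`** (the ball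
  integral in closed form for unramified unitary `ν`, `−1 < re w`, threshold `n ≤ m′ − 1`).
* §4 **`setIntegral_compl_tail_mul_addChar_inv_eq_closedForm`** (THE LETTER: `Γ^N_c(e)` in closed form, `1 < re e`; `…_mul_inv_eq_closedForm` = W-FE-1's bytes `ψ(σ(κx⁻¹))`),
  `one_sub_mul_…` (`(1 − W)·Γ = Γ̃`, no inverse),
  `gammaTilde_centre_ne_zero_of_inert` ∕ `_of_split` (`Γ̃ ≠ 0` at `W = −1` ∕ `W = 1` when `C₀ ≠ 0`).
NOT here (honest): RAMIFIED `ν` (conductor `c_ν ≥ 1`: the ball integral is ONE Gauss-sum shell `k = m′ − c_ν` by ★ `TateDirect.setIntegral_shell_addChar_mul_extend_eq_zero_of_lt∕_gt`;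
its non-vanishing `|G(ν,ψ_c)| ≠ 0` is the sequel), and W-FE-2's continuation of the FE to the centre (K2E3-p06, ★ F1's identity principle).
HONEST LABEL.  Count-neutral helper; `HC_CM` is proved only modulo the 7 printed citations (2 remaining named inputs: hLiu418 = `stmt-HodgeConjecture-24832`,
h413 = `stmt-HodgeConjecture-24833`) until rung 0 closes; B2a′ stays OPEN (W-FE-2 + the `U(2,2)_v` instantiation, K2E3-p06 (g6)).

## References
* [CasselmanShalika1980] W. Casselman, J. Shalika, *The unramified principal series of p-adic groups II: the Whittaker function*, Compositio Math. 41 (1980), §2–§4.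
* [Tate1950] J. Tate, *Fourier analysis in number fields and Hecke's zeta-functions* (1950), §2.2–§2.5 (`d^×x`, shells, orthogonality, Gauss sums).
* [Casselman1980] W. Casselman, Compositio Math. 40 (1980), §3 Thm. 3.1.   * [GanTakeda2011SiegelWeil] W. T. Gan, S. Takeda (2011), §7 Lemma 7.4.
-/

set_option autoImplicit false
set_option linter.dupNamespace false -- the mandated namespace repeats `HodgeConjecture.HodgeConjecture`

noncomputable section

open MeasureTheory Filter Topology Set
open scoped NNReal ENNReal Classical
open Literature.NumberTheory.GaloisRepresentations.IsNonarchimedeanLocalField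
open Literature.NumberTheory.Automorphic Literature.NumberTheory.Automorphic.LocalFieldHaar

namespace Summit.HodgeConjecture.HodgeConjecture.Cruxes.HLiu418.K2LiuTwistedGammaFactorLetter

variable {F : Type*} [Field F] [ValuativeRel F] [TopologicalSpace F] [IsNonarchimedeanLocalField F]

/-! ## §0 An unramified unitary character of `Fˣ` is continuous -/

/-- an UNRAMIFIED character `ν : Fˣ →* ℂˣ` (trivial on the units of norm `1`) is continuous: it is constant on the open subgroup `{‖u‖ = 1} = U⁰ ∈ 𝓝 1`
(★ `unitFiltration_mem_nhds_one`). [cite: Tate1950, §2.3] -/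
theorem continuous_of_unramified (ν : Fˣ →* ℂˣ) (hun : ∀ u : Fˣ, normAbs F (u : F) = 1 → ν u = 1) : Continuous ν := by
  refine continuous_of_continuousAt_one ν ?_
  refine (continuousAt_const : ContinuousAt (fun _ : Fˣ => (1 : ℂˣ)) 1).congr ?_
  filter_upwards [unitFiltration_mem_nhds_one (F := F) 0] with u hu
  exact (hun u (TateDirect.mem_unitFiltration_zero_iff.1 hu)).symm

/-! ## §1 The free inversion `∫ ‖x‖⁻¹ G(x⁻¹) dμ = ∫ ‖x‖⁻¹ G(x) dμ` and the ball/co-ball dictionary under `x ↦ x⁻¹` -/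

/-- for `x ≠ 0`: `x⁻¹ ∈ 𝔭^{1−N} ↔ x ∉ 𝔭^N` (the norm takes the values `q^k`, `k ∈ ℤ`). [cite: Tate1950, §2.2] -/
theorem inv_mem_primePowBall_iff_not_mem {x : F} (hx : x ≠ 0) (N : ℤ) : x⁻¹ ∈ primePowBall F (1 - N) ↔ x ∉ primePowBall F N := by
  obtain ⟨k, hk⟩ := exists_normAbs_eq_inv_zpow hx
  rw [mem_primePowBall_iff, mem_primePowBall_iff, map_inv₀, hk, ← zpow_neg, inv_residueFieldCard_zpow_le_iff, inv_residueFieldCard_zpow_le_iff]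
  omega

variable [MeasurableSpace F] [BorelSpace F] (μ : Measure F) [μ.IsAddHaarMeasure]

/-- **THE FREE INVERSION.**  For EVERY `G : F → ℂ`: `∫ ‖x‖⁻¹ • G(x⁻¹) dμ(x) = ∫ ‖x‖⁻¹ • G(x) dμ(x)` — both sides are `∫_{Fˣ} G dμ^×` for the Haar measure `μ^× = ‖·‖⁻¹μ` of the
abelian group `Fˣ` (★ `LocalFieldHaar.integral_unitsMeasure`, ★ `isHaarMeasure_unitsMeasure`), which is inversion invariant (★ `isInvInvariant_of_isHaarMeasure_units`); no
integrability is needed, and the point `0` (`0⁻¹ = 0`, weight `‖0‖⁻¹ = 0`) is invisible. [cite: Tate1950, §2.2] -/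
theorem integral_normAbs_inv_smul_comp_inv (G : F → ℂ) :
    ∫ x, ((normAbs F x)⁻¹ : ℝ) • G x⁻¹ ∂μ = ∫ x, ((normAbs F x)⁻¹ : ℝ) • G x ∂μ := by
  haveI : BorelSpace Fˣ := Units.borelSpace
  haveI := isHaarMeasure_unitsMeasure (μ := μ) (F := F)
  haveI := isInvInvariant_of_isHaarMeasure_units
    (Measure.comap ((↑) : Fˣ → F) (μ.withDensity fun x => (((normAbs F x)⁻¹ : ℝ≥0) : ℝ≥0∞)))
  rw [← integral_unitsMeasure μ G, ← integral_unitsMeasure μ (fun x => G x⁻¹)]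
  have h : ∀ u : Fˣ, G ((u : F)⁻¹) = (fun v : Fˣ => G (v : F)) u⁻¹ := fun u => by simp only [Units.val_inv_eq_inv_val]
  simp_rw [h]
  exact integral_inv_eq_self (fun v : Fˣ => G (v : F)) _

/-! ## §2 The Γ-integral is a Tate integral on a ball -/

/-- **`Γ^N_c(e) = C₀ · ∫_{𝔭^{1−N} ∖ 0} ψ(cy) · ν̃(y) · ‖y‖^{e−2} dμ(y)`** for the tail letter `T x = C₀ ν(x)⁻¹ ‖x‖^{−e}` (on units; `T 0` arbitrary — `0 ∈ 𝔭^N`):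
the free inversion §1 with `G(y) = 𝟙_{𝔭^{1−N}∖0}(y) · C₀ ν(y) ‖y‖^{e−1} ψ(cy)` (`ν(x)⁻¹ = ν(x⁻¹)`, `‖x‖^{−e} = ‖x⁻¹‖^{e}`, `x ∉ 𝔭^N ↔ x⁻¹ ∈ 𝔭^{1−N}`).  Valid for EVERY `e`
(no integrability: both sides take junk values together). [cite: Tate1950, §2.5] [cite: CasselmanShalika1980, §2] -/
theorem setIntegral_compl_tail_mul_addChar_inv_eq (ν : Fˣ →* ℂˣ) (C₀ e : ℂ) (T : F → ℂ)
    (hT : ∀ x : Fˣ, T x = C₀ * (((ν x)⁻¹ : ℂˣ) : ℂ) * (((normAbs F (x : F) : ℝ≥0) : ℝ) : ℂ) ^ (-e))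
    (ψ : AddChar F Circle) (c : F) (N : ℤ) :
    ∫ x in (primePowBall F N)ᶜ, T x * ((ψ (c * x⁻¹)) : ℂ) ∂μ =
      C₀ * ∫ y in primePowBall F (1 - N) \ {0}, ((ψ (c * y)) : ℂ) * Function.extend ((↑) : Fˣ → F) (fun u => ((ν u : ℂˣ) : ℂ)) 0 y *
        (((normAbs F y : ℝ≥0) : ℝ) : ℂ) ^ (e - 2) ∂μ := by
  haveI : T2Space F := (Literature.NumberTheory.GaloisRepresentations.IsNonarchimedeanLocalField.isLocalField F).toT2Space
  have hSm : MeasurableSet (primePowBall F (1 - N) \ {0}) := (measurableSet_primePowBall _).diff (measurableSet_singleton 0)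
  -- two pieces of `cpow` algebra at a positive real base
  have harg : ∀ y : F, ((((normAbs F y : ℝ≥0) : ℝ) : ℂ)).arg ≠ Real.pi := fun y => by
    rw [Complex.arg_ofReal_of_nonneg (NNReal.coe_nonneg _)]; exact Real.pi_pos.ne
  have hA : ∀ {r : ℂ}, r ≠ 0 → r.arg ≠ Real.pi → r⁻¹ * (r⁻¹) ^ (e - 1) = r ^ (-e) := by
    intro r hr hra
    have h1 : r ^ (e - 1) * r = r ^ e := by
      conv_rhs => rw [show e = (e - 1) + 1 by ring]
      rw [Complex.cpow_add _ _ hr, Complex.cpow_one]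
    rw [Complex.inv_cpow _ _ hra, ← mul_inv, mul_comm r, h1, Complex.cpow_neg]
  have hB : ∀ {r : ℂ}, r ≠ 0 → r⁻¹ * r ^ (e - 1) = r ^ (e - 2) := by
    intro r hr
    rw [show e - 1 = (e - 2) + 1 by ring, Complex.cpow_add _ _ hr, Complex.cpow_one]
    field_simp
  -- the function to invert
  obtain ⟨G, hG⟩ : ∃ G : F → ℂ, G = (primePowBall F (1 - N) \ {0}).indicator fun y =>
      C₀ * (Function.extend ((↑) : Fˣ → F) (fun u => ((ν u : ℂˣ) : ℂ)) 0 y * (((normAbs F y : ℝ≥0) : ℝ) : ℂ) ^ (e - 1) * ((ψ (c * y)) : ℂ)) := ⟨_, rfl⟩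
  -- (a) on the `x`-side `‖x‖⁻¹ • G(x⁻¹)` is the co-ball integrand
  have hx_side : ∀ x : F, ((normAbs F x)⁻¹ : ℝ) • G x⁻¹ = (primePowBall F N)ᶜ.indicator (fun x => T x * ((ψ (c * x⁻¹)) : ℂ)) x := by
    intro x
    by_cases hx0 : x = 0
    · subst hx0
      have h0c : (0 : F) ∉ (primePowBall F N)ᶜ := fun h => h (zero_mem_primePowBall N)
      simp only [map_zero, NNReal.coe_zero, inv_zero, zero_smul]
      rw [Set.indicator_of_notMem h0c]
    by_cases hxN : x ∈ primePowBall F N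
    · have hnot : x⁻¹ ∉ primePowBall F (1 - N) \ {0} := fun h => ((inv_mem_primePowBall_iff_not_mem hx0 N).1 h.1) hxN
      have hxc : x ∉ (primePowBall F N)ᶜ := fun h => h hxN
      rw [hG, Set.indicator_of_notMem hnot, smul_zero, Set.indicator_of_notMem hxc]
    · have hmem : x⁻¹ ∈ primePowBall F (1 - N) \ {0} := ⟨(inv_mem_primePowBall_iff_not_mem hx0 N).2 hxN, fun h => hx0 (inv_eq_zero.1 h)⟩
      have hxc : x ∈ (primePowBall F N)ᶜ := hxN
      have hTx := hT (Units.mk0 x hx0)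
      rw [Units.val_mk0] at hTx
      have hext' : Function.extend ((↑) : Fˣ → F) (fun u => ((ν u : ℂˣ) : ℂ)) 0 x⁻¹ = (((ν (Units.mk0 x hx0))⁻¹ : ℂˣ) : ℂ) := by
        rw [show x⁻¹ = (((Units.mk0 x hx0)⁻¹ : Fˣ) : F) by rw [Units.val_inv_eq_inv_val, Units.val_mk0], Units.val_injective.extend_apply, map_inv]
      have hr0 : (((normAbs F x : ℝ≥0) : ℝ) : ℂ) ≠ 0 := by exact_mod_cast (map_ne_zero (normAbs F)).2 hx0
      rw [hG, Set.indicator_of_mem hmem, Set.indicator_of_mem hxc, hTx, hext', map_inv₀, Complex.real_smul, NNReal.coe_inv, Complex.ofReal_inv,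
        ← hA hr0 (harg x)]
      ring
  -- (b) on the `y`-side `‖y‖⁻¹ • G(y)` is the ball integrand
  have hy_side : ∀ y : F, ((normAbs F y)⁻¹ : ℝ) • G y = (primePowBall F (1 - N) \ {0}).indicator
      (fun y => C₀ * (((ψ (c * y)) : ℂ) * Function.extend ((↑) : Fˣ → F) (fun u => ((ν u : ℂˣ) : ℂ)) 0 y * (((normAbs F y : ℝ≥0) : ℝ) : ℂ) ^ (e - 2))) y := by
    intro y
    by_cases hy : y ∈ primePowBall F (1 - N) \ {0}
    · have hr0 : (((normAbs F y : ℝ≥0) : ℝ) : ℂ) ≠ 0 := by exact_mod_cast (map_ne_zero (normAbs F)).2 hy.2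
      rw [hG, Set.indicator_of_mem hy, Set.indicator_of_mem hy, Complex.real_smul, Complex.ofReal_inv, ← hB hr0]
      ring
    · rw [hG, Set.indicator_of_notMem hy, Set.indicator_of_notMem hy, smul_zero]
  calc ∫ x in (primePowBall F N)ᶜ, T x * ((ψ (c * x⁻¹)) : ℂ) ∂μ
      = ∫ x, (primePowBall F N)ᶜ.indicator (fun x => T x * ((ψ (c * x⁻¹)) : ℂ)) x ∂μ := (integral_indicator (measurableSet_primePowBall N).compl).symm
    _ = ∫ x, ((normAbs F x)⁻¹ : ℝ) • G x⁻¹ ∂μ := by simp_rw [hx_side]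
    _ = ∫ y, ((normAbs F y)⁻¹ : ℝ) • G y ∂μ := integral_normAbs_inv_smul_comp_inv μ G
    _ = ∫ y, (primePowBall F (1 - N) \ {0}).indicator
          (fun y => C₀ * (((ψ (c * y)) : ℂ) * Function.extend ((↑) : Fˣ → F) (fun u => ((ν u : ℂˣ) : ℂ)) 0 y * (((normAbs F y : ℝ≥0) : ℝ) : ℂ) ^ (e - 2))) y ∂μ := by
        simp_rw [hy_side]
    _ = C₀ * ∫ y in primePowBall F (1 - N) \ {0}, ((ψ (c * y)) : ℂ) * Function.extend ((↑) : Fˣ → F) (fun u => ((ν u : ℂˣ) : ℂ)) 0 y *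
          (((normAbs F y : ℝ≥0) : ℝ) : ℂ) ^ (e - 2) ∂μ := by rw [integral_indicator hSm, integral_const_mul]

/-! ## §3 Tate's shells: `∫_{‖y‖ = q^{−k}} ψ(cy) dμ = J_k − J_{k+1}`, and the ball integral in closed form for unramified `ν` -/

/-- **One sphere against `ψ(c·)`**: `∫_{𝔭^k ∖ 𝔭^{k+1}} ψ(cy) dμ(y) = J_k(c) − J_{k+1}(c)`, `J_k(c) = μ(𝔭^k)·[c ∈ 𝔭^{m−k}]` for `ψ` of conductor exponent `m` (★ Tate orthogonality).
[cite: Tate1950, §2.5] -/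
theorem setIntegral_shell_addChar_mul_eq {ψ : AddChar F Circle} (hψ : Continuous ψ) {m : ℤ} (hm : ψ.HasConductorExp m) (c : F) (k : ℤ) :
    ∫ y in primePowBall F k \ primePowBall F (k + 1), ((ψ (c * y)) : ℂ) ∂μ =
      (if c ∈ primePowBall F (m - k) then (μ.real (primePowBall F k) : ℂ) else 0) -
        (if c ∈ primePowBall F (m - (k + 1)) then (μ.real (primePowBall F (k + 1)) : ℂ) else 0) := by
  haveI : T2Space F := (Literature.NumberTheory.GaloisRepresentations.IsNonarchimedeanLocalField.isLocalField F).toT2Space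
  have hcont : Continuous fun y : F => ((ψ (c * y)) : ℂ) := continuous_subtype_val.comp (hψ.comp (continuous_const.mul continuous_id))
  rw [setIntegral_sdiff (measurableSet_primePowBall _) (hcont.continuousOn.integrableOn_compact (isCompact_primePowBall k)) (primePowBall_antitone (by omega))]
  simp_rw [mul_comm c]
  rw [setIntegral_primePowBall_addChar_mul μ hm k c, setIntegral_primePowBall_addChar_mul μ hm (k + 1) c]

/-- **THE BALL INTEGRAL IN CLOSED FORM (unramified unitary `ν`).**  `α = ν(ϖ)`, `ψ` continuous of conductor exponent `mψ`, `‖c‖ = q^{−j_c}`, `m′ := mψ − j_c`, `−1 < re w`,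
`W := α·q^{−(w+1)}` (`‖W‖ < 1`), and the threshold `n ≤ m′ − 1`:
`∫_{𝔭^n ∖ 0} ψ(cy)·ν̃(y)·‖y‖^w dμ(y) = μ(𝒪)·W^{m′−1}·(W − q⁻¹)·(1 − W)⁻¹` — the shells `k ≥ m′` give `μ(𝒪)(1−q⁻¹)W^k`, the shell `k = m′−1` gives `−μ(𝒪)q⁻¹W^{m′−1}`,
the shells `k ≤ m′ − 2` nothing (Tate's orthogonality `J_k = μ(𝔭^k)[k ≥ m′]`). [cite: Tate1950, §2.5] [cite: CasselmanShalika1980, §4] -/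
theorem integral_ball_addChar_mul_extend_cpow_eq (ν : Fˣ →* ℂˣ) (hν : ∀ x, ‖((ν x : ℂˣ) : ℂ)‖ = 1) (hun : ∀ u : Fˣ, normAbs F (u : F) = 1 → ν u = 1)
    (ϖ : Fˣ) (hϖ : normAbs F (ϖ : F) = (residueFieldCard F : ℝ≥0)⁻¹)
    {ψ : AddChar F Circle} (hψ : Continuous ψ) {mψ : ℤ} (hmψ : ψ.HasConductorExp mψ) {c : F} {jc : ℤ} (hc : normAbs F c = (residueFieldCard F : ℝ≥0)⁻¹ ^ jc)
    {w : ℂ} (hw : -1 < w.re) {n : ℤ} (hn : n ≤ mψ - jc - 1) :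
    ∫ y in primePowBall F n \ {0}, ((ψ (c * y)) : ℂ) * Function.extend ((↑) : Fˣ → F) (fun u => ((ν u : ℂˣ) : ℂ)) 0 y * (((normAbs F y : ℝ≥0) : ℝ) : ℂ) ^ w ∂μ =
      (μ.real (primePowBall F 0) : ℂ) * (((ν ϖ : ℂˣ) : ℂ) * (residueFieldCard F : ℂ) ^ (-(w + 1))) ^ (mψ - jc - 1) *
        (((ν ϖ : ℂˣ) : ℂ) * (residueFieldCard F : ℂ) ^ (-(w + 1)) - (residueFieldCard F : ℂ)⁻¹) *
          (1 - ((ν ϖ : ℂˣ) : ℂ) * (residueFieldCard F : ℂ) ^ (-(w + 1)))⁻¹ := by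
  -- `ν` as a quasi-character: unitary (exponent `0`) and unramified
  obtain ⟨νq, hνq_apply⟩ : ∃ νq : QuasiChar F, ∀ x, νq x = ν x := ⟨⟨ν, continuous_of_unramified ν hun⟩, fun _ => rfl⟩
  have hτ : νq.HasExponent 0 := fun x => by rw [Real.rpow_zero, hνq_apply]; exact hν x
  have hχ : νq.IsUnramified := fun x hx => by rw [hνq_apply]; exact hun x hx
  have hext : Function.extend ((↑) : Fˣ → F) (fun u => ((νq u : ℂˣ) : ℂ)) 0 = Function.extend ((↑) : Fˣ → F) (fun u => ((ν u : ℂˣ) : ℂ)) 0 := by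
    congr 1; funext u; rw [hνq_apply]
  have hϖ0 : (ϖ : F) ≠ 0 := ϖ.ne_zero
  have hq0 : (residueFieldCard F : ℂ) ≠ 0 := Nat.cast_ne_zero.2 (residueFieldCard_ne_zero F)
  -- abbreviations
  obtain ⟨W, hW⟩ : ∃ W : ℂ, W = ((ν ϖ : ℂˣ) : ℂ) * (residueFieldCard F : ℂ) ^ (-(w + 1)) := ⟨_, rfl⟩
  obtain ⟨μ0, hμ0⟩ : ∃ μ0 : ℂ, μ0 = (μ.real (primePowBall F 0) : ℂ) := ⟨_, rfl⟩
  obtain ⟨m', hm'⟩ : ∃ m' : ℤ, m' = mψ - jc := ⟨_, rfl⟩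
  rw [← hW, ← hμ0, ← hm']
  -- the shell expansion (★ TateDirect) and `‖W‖ < 1`
  have hφm : Measurable fun y : F => ((ψ (c * y)) : ℂ) := (continuous_subtype_val.comp (hψ.comp (continuous_const.mul continuous_id))).measurable
  have hφ1 : ∀ y : F, ‖((ψ (c * y)) : ℂ)‖ ≤ 1 := fun y => (Circle.norm_coe _).le
  have hsum := (TateDirect.integrableOn_and_hasSum_mul_extend_cpow μ (fun y : F => ((ψ (c * y)) : ℂ)) hφm hφ1 νq hτ w (by linarith) n).2
  have hWn : ‖W‖ < 1 := by
    have h := (TateDirect.integral_ball_extend_cpow_of_isUnramified μ hχ hτ w (by linarith) hϖ n (W := W) (by rw [hW, Units.mk0_val, hνq_apply])).1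
    exact h
  have hW0 : W ≠ 0 := by rw [hW]; exact mul_ne_zero (Units.ne_zero _) (Complex.cpow_ne_zero_iff.2 (Or.inl hq0))
  -- the conductor test on the shell `k`: `c ∈ 𝔭^{mψ − k} ↔ m′ ≤ k`
  have htest : ∀ k : ℤ, c ∈ primePowBall F (mψ - k) ↔ m' ≤ k := fun k => by
    rw [mem_primePowBall_iff, hc, inv_residueFieldCard_zpow_le_iff]; omega
  have hμk : ∀ k : ℤ, (μ.real (primePowBall F k) : ℂ) = μ0 * ((residueFieldCard F : ℂ)⁻¹) ^ k := fun k => by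
    rw [measureReal_primePowBall μ k, hμ0]; push_cast; ring
  -- the series, term by term
  obtain ⟨Tm, hTm⟩ : ∃ Tm : ℕ → ℂ, Tm = fun i : ℕ => μ0 * W ^ (n + (i : ℤ)) *
      ((if m' ≤ n + i then (1 : ℂ) else 0) - (residueFieldCard F : ℂ)⁻¹ * (if m' ≤ n + i + 1 then (1 : ℂ) else 0)) := ⟨_, rfl⟩
  have hTi : ∀ i : ℕ, Tm i = μ0 * W ^ (n + (i : ℤ)) * ((if m' ≤ n + i then (1 : ℂ) else 0) - (residueFieldCard F : ℂ)⁻¹ * (if m' ≤ n + i + 1 then (1 : ℂ) else 0)) :=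
    fun i => by rw [hTm]
  have hshell : ∀ i : ℕ, ∫ y in primePowBall F (n + i) \ primePowBall F (n + i + 1),
      ((ψ (c * y)) : ℂ) * Function.extend ((↑) : Fˣ → F) (fun u => ((νq u : ℂˣ) : ℂ)) 0 y * (((normAbs F y : ℝ≥0) : ℝ) : ℂ) ^ w ∂μ = Tm i := by
    intro i
    rw [TateDirect.setIntegral_shell_mul_cpow μ _ (n + i) w, TateDirect.setIntegral_shell_mul_extend_of_isUnramified μ hχ hϖ (n + i),
      Units.mk0_val, hνq_apply, setIntegral_shell_addChar_mul_eq μ hψ hmψ c (n + i), TateDirect.natCast_cpow_neg_intCast_mul, hTi]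
    have e1 : (if c ∈ primePowBall F (mψ - (n + (i : ℤ))) then (μ.real (primePowBall F (n + i)) : ℂ) else 0) =
        μ0 * ((residueFieldCard F : ℂ)⁻¹) ^ (n + (i : ℤ)) * (if m' ≤ n + i then (1 : ℂ) else 0) := by
      by_cases h : m' ≤ n + i
      · rw [if_pos ((htest _).2 h), if_pos h, hμk, mul_one]
      · rw [if_neg (fun h' => h ((htest _).1 h')), if_neg h, mul_zero]
    have e2 : (if c ∈ primePowBall F (mψ - (n + (i : ℤ) + 1)) then (μ.real (primePowBall F (n + i + 1)) : ℂ) else 0) =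
        μ0 * ((residueFieldCard F : ℂ)⁻¹) ^ (n + (i : ℤ)) * (residueFieldCard F : ℂ)⁻¹ * (if m' ≤ n + i + 1 then (1 : ℂ) else 0) := by
      by_cases h : m' ≤ n + i + 1
      · rw [if_pos ((htest _).2 h), if_pos h, hμk, zpow_add_one₀ (inv_ne_zero hq0), mul_one, mul_assoc]
      · rw [if_neg (fun h' => h ((htest _).1 h')), if_neg h, mul_zero]
    rw [e1, e2, hW, mul_zpow]
    have e3 : ((residueFieldCard F : ℂ) ^ (-w)) ^ (n + (i : ℤ)) * ((residueFieldCard F : ℂ)⁻¹) ^ (n + (i : ℤ)) =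
        ((residueFieldCard F : ℂ) ^ (-(w + 1))) ^ (n + (i : ℤ)) := by
      rw [← mul_zpow, neg_add, Complex.cpow_add _ _ hq0, Complex.cpow_neg_one]
    rw [← e3]
    ring
  simp only [hshell] at hsum
  -- the sum: zero below `m′ − 1`, `−μ0 q⁻¹ W^{m′−1}` at `m′ − 1`, geometric from `m′` on
  obtain ⟨i₁, hi₁⟩ : ∃ i₁ : ℕ, (n : ℤ) + i₁ = m' - 1 := ⟨(m' - 1 - n).toNat, by omega⟩
  have hhead : ∑ i ∈ Finset.range (i₁ + 1), Tm i = -(μ0 * (residueFieldCard F : ℂ)⁻¹ * W ^ (m' - 1)) := by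
    rw [Finset.sum_range_succ, Finset.sum_eq_zero (fun i hi => ?_), hTi]
    · rw [if_neg (by omega), if_pos (by omega), hi₁]; ring
    · have hi' : i < i₁ := Finset.mem_range.1 hi
      rw [hTi, if_neg (by omega), if_neg (by omega)]; ring
  have htail : (fun i : ℕ => Tm (i + (i₁ + 1))) = fun i : ℕ => μ0 * (1 - (residueFieldCard F : ℂ)⁻¹) * W ^ m' * W ^ i := by
    funext i
    rw [hTi, if_pos (by push_cast; omega), if_pos (by push_cast; omega), show (n : ℤ) + ((i + (i₁ + 1) : ℕ) : ℤ) = m' + (i : ℤ) by push_cast; omega,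
      zpow_add₀ hW0, zpow_natCast]
    ring
  have key : HasSum (fun i : ℕ => Tm (i + (i₁ + 1))) (μ0 * (1 - (residueFieldCard F : ℂ)⁻¹) * W ^ m' * (1 - W)⁻¹) := by
    rw [htail]
    exact (hasSum_geometric_of_norm_lt_one hWn).mul_left (μ0 * (1 - (residueFieldCard F : ℂ)⁻¹) * W ^ m')
  have hval := (hasSum_nat_add_iff (i₁ + 1)).1 key
  rw [hhead] at hval
  have h1W : (1 - W) ≠ 0 := sub_ne_zero.2 (fun h => by rw [← h, norm_one] at hWn; exact lt_irrefl _ hWn)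
  have hv : μ0 * (1 - (residueFieldCard F : ℂ)⁻¹) * W ^ m' * (1 - W)⁻¹ + -(μ0 * (residueFieldCard F : ℂ)⁻¹ * W ^ (m' - 1)) =
      μ0 * W ^ (m' - 1) * (W - (residueFieldCard F : ℂ)⁻¹) * (1 - W)⁻¹ := by
    rw [show W ^ m' = W ^ (m' - 1) * W by rw [← zpow_add_one₀ hW0, sub_add_cancel]]
    field_simp
    ring
  rw [hv] at hval
  have hgoal := hsum.unique hval
  rw [hext] at hgoal
  rw [hgoal, hm']

/-! ## §4 THE LETTER: `Γ^N_c(e)` in closed form, its `(1 − W)`-cleared form, and non-vanishing at the centre -/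

/-- **THE Γ-FACTOR OF THE RANK-ONE ψ-WHITTAKER FUNCTIONAL EQUATION, CLOSED FORM (unramified unitary `ν`).**  In W-FE-1's letters (`T x = C₀ ν(x)⁻¹ ‖x‖^{−e}` on units,
`1 < re e`), with `α = ν(ϖ)`, `ψ` continuous of conductor exponent `mψ`, `‖c‖ = q^{−j_c}`, `m′ = mψ − j_c`, `W := α q^{1−e}` and the threshold `1 − N ≤ m′ − 1` (W-FE-1: `c = σκ`,
`N = M + k_κ + 1`, granted by `−M ≤ j`, `σ ∉ 𝔭^{c_ψ − j}`):
**`∫_{x ∉ 𝔭^N} T(x) ψ(c x⁻¹) dμ(x) = C₀ · μ(𝒪) · W^{m′−1} · (W − q⁻¹) · (1 − W)⁻¹`** — `= L(e−1, ν)·Γ̃(e)` with `L(e−1,ν) = (1 − ν(ϖ)q^{1−e})⁻¹` and the Laurent monomial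
`Γ̃(e) = C₀ μ(𝒪) W^{m′−1}(W − q⁻¹)`. [cite: CasselmanShalika1980, §4] [cite: Tate1950, §2.5] [cite: GanTakeda2011SiegelWeil, §7 Lemma 7.4] -/
theorem setIntegral_compl_tail_mul_addChar_inv_eq_closedForm (ν : Fˣ →* ℂˣ) (hν : ∀ x, ‖((ν x : ℂˣ) : ℂ)‖ = 1) (hun : ∀ u : Fˣ, normAbs F (u : F) = 1 → ν u = 1)
    (ϖ : Fˣ) (hϖ : normAbs F (ϖ : F) = (residueFieldCard F : ℝ≥0)⁻¹) (C₀ : ℂ) {e : ℂ} (he : 1 < e.re) (T : F → ℂ)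
    (hT : ∀ x : Fˣ, T x = C₀ * (((ν x)⁻¹ : ℂˣ) : ℂ) * (((normAbs F (x : F) : ℝ≥0) : ℝ) : ℂ) ^ (-e))
    {ψ : AddChar F Circle} (hψ : Continuous ψ) {mψ : ℤ} (hmψ : ψ.HasConductorExp mψ) {c : F} {jc : ℤ} (hc : normAbs F c = (residueFieldCard F : ℝ≥0)⁻¹ ^ jc)
    {N : ℤ} (hN : 1 - N ≤ mψ - jc - 1) :
    ∫ x in (primePowBall F N)ᶜ, T x * ((ψ (c * x⁻¹)) : ℂ) ∂μ =
      C₀ * (μ.real (primePowBall F 0) : ℂ) * (((ν ϖ : ℂˣ) : ℂ) * (residueFieldCard F : ℂ) ^ (1 - e)) ^ (mψ - jc - 1) *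
        (((ν ϖ : ℂˣ) : ℂ) * (residueFieldCard F : ℂ) ^ (1 - e) - (residueFieldCard F : ℂ)⁻¹) * (1 - ((ν ϖ : ℂˣ) : ℂ) * (residueFieldCard F : ℂ) ^ (1 - e))⁻¹ := by
  rw [setIntegral_compl_tail_mul_addChar_inv_eq μ ν C₀ e T hT ψ c N,
    integral_ball_addChar_mul_extend_cpow_eq μ ν hν hun ϖ hϖ hψ hmψ hc (w := e - 2) (by simp; linarith) hN,
    show -(e - 2 + 1) = 1 - e by ring]
  ring

/-- **THE `(1 − W)`-CLEARED FORM** `(1 − ν(ϖ)q^{1−e}) · Γ^N_c(e) = C₀ μ(𝒪) W^{m′−1}(W − q⁻¹)` — the Laurent monomial `Γ̃`, with no inverse (`Γ = L(e−1,ν)·Γ̃` read multiplicatively;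
W-FE-2 continues it to the centre by ★ F1's identity principle). [cite: CasselmanShalika1980, §4] [cite: GanTakeda2011SiegelWeil, §7 Lemma 7.4] -/
theorem one_sub_mul_setIntegral_compl_tail_mul_addChar_inv_eq (ν : Fˣ →* ℂˣ) (hν : ∀ x, ‖((ν x : ℂˣ) : ℂ)‖ = 1) (hun : ∀ u : Fˣ, normAbs F (u : F) = 1 → ν u = 1)
    (ϖ : Fˣ) (hϖ : normAbs F (ϖ : F) = (residueFieldCard F : ℝ≥0)⁻¹) (C₀ : ℂ) {e : ℂ} (he : 1 < e.re) (T : F → ℂ)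
    (hT : ∀ x : Fˣ, T x = C₀ * (((ν x)⁻¹ : ℂˣ) : ℂ) * (((normAbs F (x : F) : ℝ≥0) : ℝ) : ℂ) ^ (-e))
    {ψ : AddChar F Circle} (hψ : Continuous ψ) {mψ : ℤ} (hmψ : ψ.HasConductorExp mψ) {c : F} {jc : ℤ} (hc : normAbs F c = (residueFieldCard F : ℝ≥0)⁻¹ ^ jc)
    {N : ℤ} (hN : 1 - N ≤ mψ - jc - 1) :
    (1 - ((ν ϖ : ℂˣ) : ℂ) * (residueFieldCard F : ℂ) ^ (1 - e)) * ∫ x in (primePowBall F N)ᶜ, T x * ((ψ (c * x⁻¹)) : ℂ) ∂μ =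
      C₀ * (μ.real (primePowBall F 0) : ℂ) * (((ν ϖ : ℂˣ) : ℂ) * (residueFieldCard F : ℂ) ^ (1 - e)) ^ (mψ - jc - 1) *
        (((ν ϖ : ℂˣ) : ℂ) * (residueFieldCard F : ℂ) ^ (1 - e) - (residueFieldCard F : ℂ)⁻¹) := by
  have hq0 : (residueFieldCard F : ℂ) ≠ 0 := Nat.cast_ne_zero.2 (residueFieldCard_ne_zero F)
  -- `‖W‖ < 1` on `1 < re e` (so `1 − W ≠ 0`)
  have hWn : ‖((ν ϖ : ℂˣ) : ℂ) * (residueFieldCard F : ℂ) ^ (1 - e)‖ < 1 := by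
    rw [norm_mul, hν, one_mul, Complex.norm_natCast_cpow_of_pos (Nat.pos_of_ne_zero (residueFieldCard_ne_zero F)), Complex.sub_re, Complex.one_re]
    exact Real.rpow_lt_one_of_one_lt_of_neg (by exact_mod_cast one_lt_residueFieldCard F) (by linarith)
  have h1W : (1 - ((ν ϖ : ℂˣ) : ℂ) * (residueFieldCard F : ℂ) ^ (1 - e)) ≠ 0 :=
    sub_ne_zero.2 (fun h => by rw [← h, norm_one] at hWn; exact lt_irrefl _ hWn)
  rw [setIntegral_compl_tail_mul_addChar_inv_eq_closedForm μ ν hν hun ϖ hϖ C₀ he T hT hψ hmψ hc hN]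
  field_simp

/-- **W-FE-1's BYTES** (`c = σκ` written as `ψ (σ * (κ * x⁻¹))`, as in `twistedHeadSum_intertwined_eq_mul`'s right-hand factor): the same closed form.
[cite: CasselmanShalika1980, §4] [cite: Tate1950, §2.5] -/
theorem setIntegral_compl_tail_mul_addChar_mul_inv_eq_closedForm (ν : Fˣ →* ℂˣ) (hν : ∀ x, ‖((ν x : ℂˣ) : ℂ)‖ = 1) (hun : ∀ u : Fˣ, normAbs F (u : F) = 1 → ν u = 1)
    (ϖ : Fˣ) (hϖ : normAbs F (ϖ : F) = (residueFieldCard F : ℝ≥0)⁻¹) (C₀ : ℂ) {e : ℂ} (he : 1 < e.re) (T : F → ℂ)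
    (hT : ∀ x : Fˣ, T x = C₀ * (((ν x)⁻¹ : ℂˣ) : ℂ) * (((normAbs F (x : F) : ℝ≥0) : ℝ) : ℂ) ^ (-e))
    {ψ : AddChar F Circle} (hψ : Continuous ψ) {mψ : ℤ} (hmψ : ψ.HasConductorExp mψ) (σ κ : F) {jc : ℤ} (hc : normAbs F (σ * κ) = (residueFieldCard F : ℝ≥0)⁻¹ ^ jc)
    {N : ℤ} (hN : 1 - N ≤ mψ - jc - 1) :
    ∫ x in (primePowBall F N)ᶜ, T x * ((ψ (σ * (κ * x⁻¹))) : ℂ) ∂μ =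
      C₀ * (μ.real (primePowBall F 0) : ℂ) * (((ν ϖ : ℂˣ) : ℂ) * (residueFieldCard F : ℂ) ^ (1 - e)) ^ (mψ - jc - 1) *
        (((ν ϖ : ℂˣ) : ℂ) * (residueFieldCard F : ℂ) ^ (1 - e) - (residueFieldCard F : ℂ)⁻¹) * (1 - ((ν ϖ : ℂˣ) : ℂ) * (residueFieldCard F : ℂ) ^ (1 - e))⁻¹ := by
  simp_rw [← mul_assoc σ κ]
  exact setIntegral_compl_tail_mul_addChar_inv_eq_closedForm μ ν hν hun ϖ hϖ C₀ he T hT hψ hmψ hc hN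

omit [ValuativeRel F] [TopologicalSpace F] [IsNonarchimedeanLocalField F] [MeasurableSpace F] [BorelSpace F] in
/-- **`Γ̃ ≠ 0` AT THE CENTRE, INERT CASE**: at the parameter where `W = ν(ϖ) q^{1−e₀} = −1` (e.g. `ν(ϖ) = −1`, `e₀ = 1`) the monomial `C₀ μ(𝒪) (−1)^{k}((−1) − q⁻¹)` is non-zero
as soon as `C₀ ≠ 0` (`μ(𝒪) > 0`, `1 + q⁻¹ > 0`). [cite: GanTakeda2011SiegelWeil, §7 Lemma 7.4] [cite: CasselmanShalika1980, §4] -/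
theorem gammaTilde_centre_ne_zero_of_inert {C₀ : ℂ} (hC₀ : C₀ ≠ 0) {μ0 : ℝ} (hμ0 : 0 < μ0) {q : ℕ} (hq : 0 < q) (k : ℤ) :
    C₀ * (μ0 : ℂ) * (-1 : ℂ) ^ k * ((-1 : ℂ) - (q : ℂ)⁻¹) ≠ 0 := by
  have h1 : (μ0 : ℂ) ≠ 0 := by exact_mod_cast hμ0.ne'
  have h2 : (-1 : ℂ) ^ k ≠ 0 := zpow_ne_zero k (by norm_num)
  have h3 : ((-1 : ℂ) - (q : ℂ)⁻¹) ≠ 0 := by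
    have : (0 : ℝ) < 1 + (q : ℝ)⁻¹ := by positivity
    intro h
    have h' : ((-(1 + (q : ℝ)⁻¹) : ℝ) : ℂ) = 0 := by push_cast; linear_combination h
    exact this.ne' (neg_eq_zero.1 (by exact_mod_cast h'))
  exact mul_ne_zero (mul_ne_zero (mul_ne_zero hC₀ h1) h2) h3

omit [ValuativeRel F] [TopologicalSpace F] [IsNonarchimedeanLocalField F] [MeasurableSpace F] [BorelSpace F] in
/-- **`Γ̃ ≠ 0` AT THE CENTRE, SPLIT (pole) CASE**: at `W = 1` the monomial `C₀ μ(𝒪)(1 − q⁻¹)` is non-zero for `C₀ ≠ 0`, `q > 1` — consistent with ★ B2a-core's pole-case scalar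
`C₀(1 − q⁻¹)μ(𝒪)`. [cite: GanTakeda2011SiegelWeil, §7 Lemma 7.4] -/
theorem gammaTilde_centre_ne_zero_of_split {C₀ : ℂ} (hC₀ : C₀ ≠ 0) {μ0 : ℝ} (hμ0 : 0 < μ0) {q : ℕ} (hq : 1 < q) (k : ℤ) :
    C₀ * (μ0 : ℂ) * (1 : ℂ) ^ k * ((1 : ℂ) - (q : ℂ)⁻¹) ≠ 0 := by
  have h1 : (μ0 : ℂ) ≠ 0 := by exact_mod_cast hμ0.ne'
  have h3 : ((1 : ℂ) - (q : ℂ)⁻¹) ≠ 0 := by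
    have hq' : (1 : ℝ) < q := by exact_mod_cast hq
    have : (0 : ℝ) < 1 - (q : ℝ)⁻¹ := by rw [sub_pos]; exact inv_lt_one_of_one_lt₀ hq'
    intro h
    have h' : (((1 - (q : ℝ)⁻¹) : ℝ) : ℂ) = 0 := by push_cast; exact h
    exact this.ne' (by exact_mod_cast h')
  rw [one_zpow, mul_one]
  exact mul_ne_zero (mul_ne_zero hC₀ h1) h3

end Summit.HodgeConjecture.HodgeConjecture.Cruxes.HLiu418.K2LiuTwistedGammaFactorLetter

end
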